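import Summits.NavierStokesRegularity.FluidComputer.TubeTablePost18
import HarnessLib

/-!
# Kernel run of the post-ramp box tube, chunks 24 … 29 (bp3 gen 16)

HONEST FRAMING: low prior, high value-of-information experiment on Tao's machine paradigm; NOT a
claim that NS blows up.

Kernel evaluations (`decide +kernel`; no `native_decide`, no extra axioms) of the in-tree tube checker
`runTube` (`P = 60`, 12 Taylor terms, cube `Rt`, read-out `CLt`) on the chunks `cP 24 … cP 29`
(= design chunks `cT 42 … cT 47`) of `TubeTablePost18.lean`, each from the recorded boundary
state `sP i` to `sP (i+1)`.

[cite: Tao2016AveragedNS, §5.5 Thm 5.3 (5.5)]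
-/

namespace Summit.NavierStokesRegularity.FluidComputer

namespace TubeTablePost18

open Literature.Analysis.FluidPDE.FluidComputer Literature.Analysis.FluidPDE.FluidComputer.TubeTable
open Literature.Analysis.FluidPDE.FluidComputer.ThresholdLevelTable (GIt)

set_option maxHeartbeats 10000000 in
set_option maxRecDepth 200000 in
/-- Chunk 24 of the post-ramp tube run (design chunk 42: 50 steps at `h = 2^-11`). [folklore] -/
theorem runP_24 : runTube 60 12 GIt CLt Rt (sP 24) (cP 24) = some (sP (24 + 1)) := by
  decide +kernel

set_option maxHeartbeats 10000000 in
set_option maxRecDepth 200000 in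
/-- Chunk 25 of the post-ramp tube run (design chunk 43: 20 steps at `h = 2^-11`). [folklore] -/
theorem runP_25 : runTube 60 12 GIt CLt Rt (sP 25) (cP 25) = some (sP (25 + 1)) := by
  decide +kernel

set_option maxHeartbeats 10000000 in
set_option maxRecDepth 200000 in
/-- Chunk 26 of the post-ramp tube run (design chunk 44: 50 steps at `h = 2^-13`). [folklore] -/
theorem runP_26 : runTube 60 12 GIt CLt Rt (sP 26) (cP 26) = some (sP (26 + 1)) := by
  decide +kernel

set_option maxHeartbeats 10000000 in
set_option maxRecDepth 200000 in
/-- Chunk 27 of the post-ramp tube run (design chunk 45: 50 steps at `h = 2^-13`). [folklore] -/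
theorem runP_27 : runTube 60 12 GIt CLt Rt (sP 27) (cP 27) = some (sP (27 + 1)) := by
  decide +kernel

set_option maxHeartbeats 10000000 in
set_option maxRecDepth 200000 in
/-- Chunk 28 of the post-ramp tube run (design chunk 46: 50 steps at `h = 2^-13`). [folklore] -/
theorem runP_28 : runTube 60 12 GIt CLt Rt (sP 28) (cP 28) = some (sP (28 + 1)) := by
  decide +kernel

set_option maxHeartbeats 10000000 in
set_option maxRecDepth 200000 in
/-- Chunk 29 of the post-ramp tube run (design chunk 47: 33 steps at `h = 2^-13`). [folklore] -/
theorem runP_29 : runTube 60 12 GIt CLt Rt (sP 29) (cP 29) = some (sP (29 + 1)) := by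
  decide +kernel

end TubeTablePost18

end Summit.NavierStokesRegularity.FluidComputer
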